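import Summits.SmoothPoincare4.SmoothPoincare4.Theses.EntropyRung

/-!
# Negative-side lemmas for the crux `EntropyRung.SubcylindricalExistence` (stmt-SmoothPoincare4-10871):
# logical position — SPC4-hard in both directions

* `psc_of_subcylindricalExistence`: the crux contains PSC-existence on every smooth homotopy 4-sphere (itself open);
* `not_subcylindricalExistence_of_not_spc4`: given the rung `SubcylindricalRecognition`, an exotic 4-sphere refutes
  the crux (contrapositive of the route's deciding theorem `closes`);
* `subcylindricalExistence_of_spc4_of_transport`: conversely SPC4 plus "every `M` diffeomorphic to `S⁴` carries a
  witness" (the round metric pulled back: `ν(S⁴_round) = log 6 − 2 > ν_cyl`, Cao–Hamilton–Ilmanen 2004 Thm 3.4, and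
  invariance of `R`, `|∇f|²`, `dV` under diffeomorphisms — neither in the library, hence a hypothesis) gives the crux;
* `subcylindricalExistence_iff_spc4`: so, modulo the rung and the transported round witness, ENT ⇔ SPC4 — a disproof
  of the crux is exactly an exotic `S⁴` together with an entropy detector for it.
Bookkeeping only; see the cdisprove record `Disproof.lean` attached to the item, §2. [folklore]
-/

noncomputable section

open scoped Manifold ContDiff ContinuousMap
open MeasureTheory Set Literature.Geometry.Lorentzian
open Summit.SmoothPoincare4.SmoothPoincare4.Theses.EntropyRung

namespace Summit.SmoothPoincare4.Cruxes.SubcylindricalExistence.Negative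

/-- **PSC projection.** The crux implies that every closed smooth homotopy 4-sphere carries a Riemannian metric
with Levi-Civita connection and positive scalar curvature (open for a would-be exotic `S⁴`: Gromov–Lawson–Stolz
need `n ≥ 5`). [folklore] -/
theorem psc_of_subcylindricalExistence (h : SubcylindricalExistence)
    (M : Type) [TopologicalSpace M] [T2Space M] [SecondCountableTopology M]
    [ChartedSpace (EuclideanSpace ℝ (Fin 4)) M] [IsManifold (𝓡 4) ∞ M] [CompactSpace M] [T3Space M]
    [MeasurableSpace M] [BorelSpace M] (e : M ≃ₕ Metric.sphere (0 : EuclideanSpace ℝ (Fin 5)) 1) :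
    ∃ g : PseudoRiemannianMetric (𝓡 4) ∞ (EuclideanSpace ℝ (Fin 4)) (TangentSpace (𝓡 4) : M → Type _),
      ∃ _ : g.HasLeviCivita, ∃ _ : g.IsRiemannian, ∀ x : M, 0 < g.scalarCurvature x := by
  obtain ⟨g, hLC, hg, hR, -⟩ := h M e
  exact ⟨g, hLC, hg, hR⟩

/-- **¬SPC4 ⇒ ¬ENT given the rung**: an exotic 4-sphere kills the crux as soon as `SubcylindricalRecognition`
holds (contrapositive of `closes`). [folklore] -/
theorem not_subcylindricalExistence_of_not_spc4 (hRung : SubcylindricalRecognition)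
    (h : ¬ _root_.SmoothPoincare4) : ¬ SubcylindricalExistence :=
  fun hEnt ↦ h (closes hRung hEnt)

/-- **SPC4 ⇒ ENT modulo the transported round witness**: if every homotopy 4-sphere is diffeomorphic to `S⁴` and
every `M` of the summit binder diffeomorphic to `S⁴` carries a witness metric (hypothesis `hW`: the round metric
pulled back), the crux holds. [folklore] -/
theorem subcylindricalExistence_of_spc4_of_transport
    (hW : ∀ (M : Type) [TopologicalSpace M] [T2Space M] [SecondCountableTopology M]
      [ChartedSpace (EuclideanSpace ℝ (Fin 4)) M] [IsManifold (𝓡 4) ∞ M] [CompactSpace M] [T3Space M]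
      [MeasurableSpace M] [BorelSpace M],
      Nonempty (M ≃ₘ⟮𝓡 4, 𝓡 4⟯ Metric.sphere (0 : EuclideanSpace ℝ (Fin 5)) 1) →
      ∃ g : PseudoRiemannianMetric (𝓡 4) ∞ (EuclideanSpace ℝ (Fin 4)) (TangentSpace (𝓡 4) : M → Type _),
        ∃ _ : g.HasLeviCivita, ∃ hg : g.IsRiemannian, (∀ x : M, 0 < g.scalarCurvature x) ∧
          ∃ δ : ℝ, 0 < δ ∧ ∀ τ : ℝ, 0 < τ → ∀ f : M → ℝ, ContMDiff (𝓡 4) 𝓘(ℝ, ℝ) ∞ f →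
            ∫ x, (4 * Real.pi * τ) ^ (-(4 : ℝ) / 2) * Real.exp (-f x)
              ∂(riemannianMeasure (g.toContMDiffRiemannianMetric hg)) = 1 →
            Real.log 2 + Real.log Real.pi / 2 - 3 / 2 + δ ≤
              ∫ x, (τ * (g.scalarCurvature x + g.gradSq f x) + f x - 4) *
                ((4 * Real.pi * τ) ^ (-(4 : ℝ) / 2) * Real.exp (-f x))
                ∂(riemannianMeasure (g.toContMDiffRiemannianMetric hg)))
    (h : _root_.SmoothPoincare4) : SubcylindricalExistence := by
  intro M _ _ _ _ _ _ _ _ _ e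
  exact hW M (h M ‹ChartedSpace (EuclideanSpace ℝ (Fin 4)) M› ‹IsManifold (𝓡 4) ∞ M› e)

/-- **ENT ⇔ SPC4** modulo the rung and the transported round witness: the crux is exactly SPC4-hard, in both
directions; its only closable content today is the round witness on manifolds KNOWN to be `S⁴`. [folklore] -/
theorem subcylindricalExistence_iff_spc4 (hRung : SubcylindricalRecognition)
    (hW : ∀ (M : Type) [TopologicalSpace M] [T2Space M] [SecondCountableTopology M]
      [ChartedSpace (EuclideanSpace ℝ (Fin 4)) M] [IsManifold (𝓡 4) ∞ M] [CompactSpace M] [T3Space M]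
      [MeasurableSpace M] [BorelSpace M],
      Nonempty (M ≃ₘ⟮𝓡 4, 𝓡 4⟯ Metric.sphere (0 : EuclideanSpace ℝ (Fin 5)) 1) →
      ∃ g : PseudoRiemannianMetric (𝓡 4) ∞ (EuclideanSpace ℝ (Fin 4)) (TangentSpace (𝓡 4) : M → Type _),
        ∃ _ : g.HasLeviCivita, ∃ hg : g.IsRiemannian, (∀ x : M, 0 < g.scalarCurvature x) ∧
          ∃ δ : ℝ, 0 < δ ∧ ∀ τ : ℝ, 0 < τ → ∀ f : M → ℝ, ContMDiff (𝓡 4) 𝓘(ℝ, ℝ) ∞ f →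
            ∫ x, (4 * Real.pi * τ) ^ (-(4 : ℝ) / 2) * Real.exp (-f x)
              ∂(riemannianMeasure (g.toContMDiffRiemannianMetric hg)) = 1 →
            Real.log 2 + Real.log Real.pi / 2 - 3 / 2 + δ ≤
              ∫ x, (τ * (g.scalarCurvature x + g.gradSq f x) + f x - 4) *
                ((4 * Real.pi * τ) ^ (-(4 : ℝ) / 2) * Real.exp (-f x))
                ∂(riemannianMeasure (g.toContMDiffRiemannianMetric hg))) :
    SubcylindricalExistence ↔ _root_.SmoothPoincare4 :=
  ⟨fun hEnt ↦ closes hRung hEnt, subcylindricalExistence_of_spc4_of_transport hW⟩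

end Summit.SmoothPoincare4.Cruxes.SubcylindricalExistence.Negative

end
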